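import Summits.CriticalPhenomena.PercolationContinuityZ3.Theorems.SoloInformedBeamGluing
import HarnessLib
import HarnessLib.Audit.Tags

/-!
# The last reduction, end to end: square-beam seed + windowed reflection step ⇒ `θ(p_c) = 0` on `ℤ³`
(solo seat `solo-CriticalPhenomena-informed`, paper §8.1 and erratum (d7.2′))

The paper's final form (§8.1) reads the conjunct `θ(p_c) = 0` on `ℤ³` through the box faces as the
conjunction of two statements about closed dual sheets at `p_c`:

* **(SB) square-beam seed** — with some `ε = 1/q` and `c > 0`, the beam
  `[0,(1+ε)n] × [0,n] × [0,n]` has no open bottom–top crossing with probability `≥ c`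
  (`SquareBeamSeed q c`: every orientation, all large scales `n = q u`);
* **(BR_j) windowed reflection step** — for some fixed `j`: if the anchor `(h, jb; t₀)`, the
  transversal `(m, jb; 2h)` and `Ξ = (t₀, jb; h)` are blocked with probability `≥ c`, `t₀ ≤ m`,
  then `(2m − t₀, b; 2h)` is blocked with probability `≥ c'(c) > 0` (`ReflectionStepFrac j`,
  typed as an inequality between box-blocking probabilities at `p_c(ℤ³)` in one fixed
  orientation: vertical `0`, longitudinal `1`, passive `2`).

This file certifies the assembly **(SB) + (BR_j) ⇒ `PercolationContinuityZ3`** in the kernel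
(`percolationContinuityZ3_of_squareBeamSeed`), composing

1. the RSW extension step for sheets iterated to square beams of every length
   (`real_beam_iter`, file `SoloInformedBeamGluing`: lengths `n + 2^i u` from `n + u` and cubes,
   the connector of each step being a cube crossing, `real_curtainCrossing_eq`);
2. the `ℤ³` identity exchanging the longitudinal and the passive direction (`xBox_swap_three`)
   and monotonicity in the lateral extents (`vertCrossing_mono`), which turn long square beams
   into the anchor, the transversal and `Ξ` of (BR_j) with `h = t₀ = 2u'`, `m = 4u'`, `b = 6u'`
   (`real_longBeam`, `real_slabCrossing_compl_ge_of_seed`);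
3. one application of (BR_j), whose output `(6u', 6u'; 4u')` is — after a translation by `u'`
   along the vertical (`real_slabCrossing_four_eq`) — the near-cube brick of the cube face with
   `r = 4`; `percolationContinuityZ3_of_slabCrossing_le` (file `SoloInformedCubeFace`) closes.

ERRATUM CERTIFIED HERE (d7.2′).  The informal reading "(SB) along a scale sequence suffices" in
§8.1/(d7.2) is off by one scale: step 3 consumes square beams of cross-sections `2u'` AND `4u'`
(anchor/`Ξ` at thickness `h`, transversal at thickness `2h`), so the seed is needed at two scales in
ratio `2` simultaneously.  The sharp hypothesis is therefore the two-scale form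
`percolationContinuityZ3_of_twoScaleSeed` (`∃ᶠ w`, seed at `u = 2w` and `u = 4w` for all
orientations), which `SquareBeamSeed` ("all large `u`") implies; a seed along an arbitrary sparse
sequence of scales is NOT shown to suffice.

Nothing here is new percolation theory: Harris–FKG, translation invariance and bookkeeping.  The two
hypotheses are exactly the residual inputs N7 of the paper; neither is proved or refuted here.

References: B. Bollobás, O. Riordan, *A short proof of the Harris–Kesten theorem*, Bull. LMS 38
(2006) 470–484 (the reflection step, Lemma 6); G. Grimmett, *Percolation*, 2nd ed., Springer 1999,
§11.7; I. Benjamini, G. Kalai, *Around two theorems and a lemma by Lucio Russo*, Math. Mech. Compl.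
Sys. 6 (2018) 69–75, p. 71 ("RSW for plaquettes in cubes" as an open problem). [folklore assembly]
-/

noncomputable section

namespace Summit.CriticalPhenomena.PercolationContinuityZ3.Theorems

open MeasureTheory ProbabilityTheory Filter Topology
open Literature.Probability.Percolation Literature.Probability.LatticeModels
open Literature.Probability.Percolation.CerfDembinVanishing
open scoped ENNReal

namespace SurfaceTension

/-! ## `ℤ³`: exchanging the longitudinal and the passive direction -/

/-- In `Fin 3`, an index different from two of three pairwise distinct indices is the third. -/
private theorem fin3_third (k₀ k₁ k₂ j : Fin 3) (h₀₁ : k₀ ≠ k₁) (h₀₂ : k₀ ≠ k₂)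
    (h₁₂ : k₁ ≠ k₂) (hj₀ : j ≠ k₀) (hj₁ : j ≠ k₁) : j = k₂ := by
  have h0 := k₀.isLt; have h1 := k₁.isLt; have h2 := k₂.isLt; have h3 := j.isLt
  simp only [ne_eq, Fin.ext_iff] at h₀₁ h₀₂ h₁₂ hj₀ hj₁ ⊢
  omega

/-- In `ℤ³` (directions `k₀, k₁, k₂` distinct) the box `B[0,A]` with longitudinal direction `k₁`
and width `ℓ` IS the box `B[0,ℓ]` with longitudinal direction `k₂` and width `A`. -/
theorem xBox_swap_three {k₀ k₁ k₂ : Fin 3} (h₀₁ : k₀ ≠ k₁) (h₀₂ : k₀ ≠ k₂) (h₁₂ : k₁ ≠ k₂)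
    (ℓ A t : ℕ) : xBox ℓ t k₀ k₁ 0 (A : ℕ) = xBox A t k₀ k₂ 0 (ℓ : ℕ) := by
  ext x
  simp only [xBox, Set.mem_setOf_eq]
  constructor
  · rintro ⟨h1, h0, h2⟩
    refine ⟨h2 k₂ (Ne.symm h₀₂) (Ne.symm h₁₂), h0, fun j hj₀ hj₂ => ?_⟩
    have hj := fin3_third _ _ _ _ h₀₂ h₀₁ (Ne.symm h₁₂) hj₀ hj₂
    subst hj
    exact h1
  · rintro ⟨h1, h0, h2⟩
    refine ⟨h2 k₁ (Ne.symm h₀₁) h₁₂, h0, fun j hj₀ hj₁ => ?_⟩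
    have hj := fin3_third _ _ _ _ h₀₁ h₀₂ h₁₂ hj₀ hj₁
    subst hj
    exact h1

/-- The corresponding identity of crossing events. -/
theorem vertCrossing_swap_three {k₀ k₁ k₂ : Fin 3} (h₀₁ : k₀ ≠ k₁) (h₀₂ : k₀ ≠ k₂)
    (h₁₂ : k₁ ≠ k₂) (ℓ A t : ℕ) :
    vertCrossing ℓ t k₀ k₁ 0 (A : ℕ) = vertCrossing A t k₀ k₂ 0 (ℓ : ℕ) := by
  simp only [vertCrossing, xBot, xTop, xBox_swap_three h₀₁ h₀₂ h₁₂]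

/-! ## The two residual inputs, typed -/


/-- **(SB) square-beam seed** with `ε = 1/q` and constant `c`: in every orientation (vertical
`k₀`, elongated direction `k₁`) and for all large `u`, the beam of cross-section `qu × qu` and
longitudinal extent `(q+1)u = (1 + 1/q)·qu` has NO open bottom–top crossing inside it at
`p_c(ℤ³)` with probability at least `c`.  (Paper §8.1 (SB); type `0 → 1` in the sheet calculus;
the `d = 3` analogue of the RSW seed, open — cf. Benjamini–Kalai 2018, p. 71.)  Conjectural; used
only as a hypothesis. -/
@[conjecture]
def SquareBeamSeed (q : ℕ) (c : ℝ) : Prop :=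
  ∀ k₀ k₁ : Fin 3, k₀ ≠ k₁ → ∀ᶠ u : ℕ in atTop,
    c ≤ (bondPercolation (zdGraph 3) (criticalProbI 3)).real
      (vertCrossing (q * u) (q * u) k₀ k₁ 0 ((q + 1) * u : ℕ))ᶜ

/-- **(BR_j) windowed reflection step** (paper §8.1, (d9.3)), as an inequality between
box-blocking probabilities at `p_c(ℤ³)` in the orientation vertical `0`, longitudinal `1`, passive
`2`: for every `c > 0` there is `c' > 0` such that for all `h, t₀ ≤ m, b`, if
the ANCHOR `(h, jb; t₀)` (vertical `1`, extent `h` along `0`, passive width `jb`), the TRANSVERSAL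
`(m, jb; 2h)` and `Ξ = (t₀, jb; h)` (vertical `0`, extents along `1`) are each blocked with
probability `≥ c`, then the output `(2m − t₀, b; 2h)` — the glued sheet over a passive window of
one `j`-th of the width — is blocked with probability `≥ c'`.  (Type `1 → 2`; carries the summit
content, paper N7; the `d = 3` analogue of Bollobás–Riordan 2006, Lemma 6.)  Conjectural; used only
as a hypothesis. -/
@[conjecture]
def ReflectionStepFrac (j : ℕ) : Prop :=
  ∀ c : ℝ, 0 < c → ∃ c' : ℝ, 0 < c' ∧ ∀ h t₀ m b : ℕ, t₀ ≤ m →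
    c ≤ (bondPercolation (zdGraph 3) (criticalProbI 3)).real
      (vertCrossing (j * b) t₀ (1 : Fin 3) 0 0 (h : ℕ))ᶜ →
    c ≤ (bondPercolation (zdGraph 3) (criticalProbI 3)).real
      (vertCrossing (j * b) (2 * h) (0 : Fin 3) 1 0 (m : ℕ))ᶜ →
    c ≤ (bondPercolation (zdGraph 3) (criticalProbI 3)).real
      (vertCrossing (j * b) h (0 : Fin 3) 1 0 (t₀ : ℕ))ᶜ →
    c' ≤ (bondPercolation (zdGraph 3) (criticalProbI 3)).real
      (vertCrossing b (2 * h) (0 : Fin 3) 1 0 (2 * m - t₀ : ℕ))ᶜ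

/-! ## From the seed at scales `2u'` and `4u'` to the inputs of (BR_j) at mesh `u'` -/

/-- Long square beams from the seed at one scale: if in orientation `(k₀, k₁)` the
`(n+u)`-beam of cross-section `n` and, in orientation `(k₁, k₀)`, the `(n+u)`-beam are blocked
with probability `≥ c`, then (the cube with vertical `k₁` being blocked with probability `≥ c` by
monotonicity) the beam of every extent `W ≤ n + 2^i u`, written with the passive direction `k₂` as
its longitudinal one and the long direction as its width, is blocked with probability `≥ c_i`. -/
theorem real_longBeam (p : unitInterval) {k₀ k₁ k₂ : Fin 3} (h₀₁ : k₀ ≠ k₁) (h₀₂ : k₀ ≠ k₂)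
    (h₁₂ : k₁ ≠ k₂) {c : ℝ} (hc : 0 < c) (i : ℕ) :
    ∃ c' : ℝ, 0 < c' ∧ ∀ n u W : ℕ, W ≤ n + 2 ^ i * u →
      c ≤ (bondPercolation (zdGraph 3) p).real (vertCrossing n n k₀ k₁ 0 (n + u : ℕ))ᶜ →
      c ≤ (bondPercolation (zdGraph 3) p).real (vertCrossing n n k₁ k₀ 0 (n + u : ℕ))ᶜ →
      c' ≤ (bondPercolation (zdGraph 3) p).real (vertCrossing W n k₀ k₂ 0 (n : ℕ))ᶜ := by
  obtain ⟨c', hc', h'⟩ := real_beam_iter p h₀₁ hc i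
  refine ⟨c', hc', fun n u W hW h₁ h₂ => ?_⟩
  have hcube : c ≤ (bondPercolation (zdGraph 3) p).real (vertCrossing n n k₁ k₀ 0 (n : ℕ))ᶜ :=
    h₂.trans (real_vertCrossing_compl_anti p le_rfl n k₁ k₀ 0 (by push_cast; linarith))
  have hbeam := h' n u h₁ hcube
  rw [vertCrossing_swap_three h₀₁ h₀₂ h₁₂] at hbeam
  exact hbeam.trans (real_vertCrossing_compl_anti p hW n k₀ k₂ 0 le_rfl)

/-- **The assembly at one mesh.** Abbreviate `P = P_{p_c(ℤ³)}` and let `q, j ≥ 1`, `c > 0`.  There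
is `c'' > 0` (depending on `q, j, c` and the function `c ↦ c'` of (BR_j)) such that for every `w`:
if the seed inequalities hold at the two scales `u = 2w` and `u = 4w` in the four orientations
`(1,2), (2,1), (0,2), (2,0)`, then the near-cube brick of mesh `u' = qw` is blocked with
probability `≥ c''`. -/
theorem real_slabCrossing_compl_ge_of_seed (q : ℕ) {j : ℕ} {c : ℝ} (hc : 0 < c)
    (hBR : ReflectionStepFrac j) :
    ∃ c'' : ℝ, 0 < c'' ∧ ∀ w : ℕ,
      (∀ k₀ k₁ : Fin 3, k₀ ≠ k₁ →
        c ≤ (bondPercolation (zdGraph 3) (criticalProbI 3)).real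
          (vertCrossing (q * (2 * w)) (q * (2 * w)) k₀ k₁ 0 ((q + 1) * (2 * w) : ℕ))ᶜ ∧
        c ≤ (bondPercolation (zdGraph 3) (criticalProbI 3)).real
          (vertCrossing (q * (4 * w)) (q * (4 * w)) k₀ k₁ 0 ((q + 1) * (4 * w) : ℕ))ᶜ) →
      c'' ≤ (bondPercolation (zdGraph 3) (criticalProbI 3)).real
        (slabCrossing (q * w) 4 (0 : Fin 3) 0)ᶜ := by
  -- number of doublings: `2^i ≥ 3jq`
  set i : ℕ := 3 * j * q with hi
  have hi2 : 3 * j * q ≤ 2 ^ i := (Nat.lt_two_pow_self (n := 3 * j * q)).le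
  have h10 : (1 : Fin 3) ≠ 0 := by decide
  have h12 : (1 : Fin 3) ≠ 2 := by decide
  have h02 : (0 : Fin 3) ≠ 2 := by decide
  have h01 : (0 : Fin 3) ≠ 1 := by decide
  -- anchor: orientation (1, 2) swapped to (1, 0); transversal and Ξ: (0, 2) swapped to (0, 1)
  obtain ⟨c₁, hc₁, hA⟩ := real_longBeam (criticalProbI 3) h12 h10 (by decide : (2 : Fin 3) ≠ 0) hc i
  obtain ⟨c₂, hc₂, hT⟩ := real_longBeam (criticalProbI 3) h02 h01 (by decide : (2 : Fin 3) ≠ 1) hc i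
  set c₀ := min c₁ c₂ with hc₀
  have hc₀pos : 0 < c₀ := lt_min hc₁ hc₂
  obtain ⟨c', hc', hBR'⟩ := hBR c₀ hc₀pos
  refine ⟨c', hc', fun w hw => ?_⟩
  -- the two scales
  set n₁ := q * (2 * w) with hn₁
  set n₂ := q * (4 * w) with hn₂
  have e₁ : (q + 1) * (2 * w) = n₁ + 2 * w := by rw [hn₁]; ring
  have e₂ : (q + 1) * (4 * w) = n₂ + 4 * w := by rw [hn₂]; ring
  have hW₁ : j * (6 * (q * w)) ≤ n₁ + 2 ^ i * (2 * w) := by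
    have : j * (6 * (q * w)) = (3 * j * q) * (2 * w) := by ring
    rw [this]
    exact (Nat.mul_le_mul_right _ hi2).trans (Nat.le_add_left _ _)
  have hW₂ : j * (6 * (q * w)) ≤ n₂ + 2 ^ i * (4 * w) := by
    have : j * (6 * (q * w)) ≤ (3 * j * q) * (4 * w) := by
      have e : (3 * j * q) * (4 * w) = 2 * (j * (6 * (q * w))) := by ring
      rw [e]; omega
    exact (this.trans (Nat.mul_le_mul_right _ hi2)).trans (Nat.le_add_left _ _)
  -- anchor `(h, jb; t₀)` with `h = t₀ = n₁`, vertical 1, longitudinal 0, width `j b`, `b = 6qw`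
  have hanchor : c₀ ≤ (bondPercolation (zdGraph 3) (criticalProbI 3)).real (vertCrossing (j * (6 * (q * w))) n₁ (1 : Fin 3) 0 0 (n₁ : ℕ))ᶜ := by
    have h1 := (hw 1 2 h12).1
    have h2 := (hw 2 1 (by decide)).1
    rw [e₁] at h1 h2
    exact (min_le_left _ _).trans (hA n₁ (2 * w) _ hW₁ h1 h2)
  -- transversal `(m, jb; 2h)` with `m = 2h = n₂`, vertical 0, longitudinal 1
  have htrans : c₀ ≤ (bondPercolation (zdGraph 3) (criticalProbI 3)).real (vertCrossing (j * (6 * (q * w))) n₂ (0 : Fin 3) 1 0 (n₂ : ℕ))ᶜ := by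
    have h1 := (hw 0 2 h02).2
    have h2 := (hw 2 0 (by decide)).2
    rw [e₂] at h1 h2
    exact (min_le_right _ _).trans (hT n₂ (4 * w) _ hW₂ h1 h2)
  -- `Ξ = (t₀, jb; h)` with `t₀ = h = n₁`, vertical 0, longitudinal 1
  have hXi : c₀ ≤ (bondPercolation (zdGraph 3) (criticalProbI 3)).real (vertCrossing (j * (6 * (q * w))) n₁ (0 : Fin 3) 1 0 (n₁ : ℕ))ᶜ := by
    have h1 := (hw 0 2 h02).1
    have h2 := (hw 2 0 (by decide)).1
    rw [e₁] at h1 h2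
    have hW₁' : j * (6 * (q * w)) ≤ n₁ + 2 ^ i * (2 * w) := hW₁
    exact (min_le_right _ _).trans (hT n₁ (2 * w) _ hW₁' h1 h2)
  -- apply (BR_j) with `h = t₀ = n₁`, `m = n₂ = 2 n₁`, `b = 6 q w`
  have hn₂' : n₂ = 2 * n₁ := by rw [hn₁, hn₂]; ring
  have hout := hBR' n₁ n₁ n₂ (6 * (q * w)) (by rw [hn₂']; omega) hanchor
    (by rw [← hn₂']; exact htrans) hXi
  have eo : 2 * n₂ - n₁ = 6 * (q * w) := by rw [hn₂', hn₁]; ring_nf; omega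
  have eh : 2 * n₁ = 4 * (q * w) := by rw [hn₁]; ring
  rw [eo, eh] at hout
  rw [probReal_compl_eq_one_sub (measurableSet_slabCrossing _ _ _ _),
    real_slabCrossing_four_eq (criticalProbI 3) (q * w) h01,
    ← probReal_compl_eq_one_sub (measurableSet_vertCrossing _ _ _ _ _ _)]
  exact hout

/-! ## The end-to-end theorems -/

/-- **Two-scale seed + (BR_j) ⇒ `θ(p_c) = 0` on `ℤ³`** (the sharp form of the last reduction,
erratum (d7.2′)): if for some `q, j ≥ 1` and `c > 0` the square-beam seed inequalities with
`ε = 1/q` hold, for infinitely many `w`, SIMULTANEOUSLY at the scales `u = 2w` and `u = 4w` and in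
every orientation, and the windowed reflection step (BR_j) holds, then `θ(p_c) = 0` on `ℤ³`. -/
theorem percolationContinuityZ3_of_twoScaleSeed {q j : ℕ} (hq : 1 ≤ q) {c : ℝ} (hc : 0 < c)
    (hSB : ∃ᶠ w : ℕ in atTop, ∀ k₀ k₁ : Fin 3, k₀ ≠ k₁ →
      c ≤ (bondPercolation (zdGraph 3) (criticalProbI 3)).real
        (vertCrossing (q * (2 * w)) (q * (2 * w)) k₀ k₁ 0 ((q + 1) * (2 * w) : ℕ))ᶜ ∧
      c ≤ (bondPercolation (zdGraph 3) (criticalProbI 3)).real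
        (vertCrossing (q * (4 * w)) (q * (4 * w)) k₀ k₁ 0 ((q + 1) * (4 * w) : ℕ))ᶜ)
    (hBR : ReflectionStepFrac j) : PercolationContinuityZ3 := by
  obtain ⟨c'', hc'', key⟩ := real_slabCrossing_compl_ge_of_seed q hc hBR
  refine percolationContinuityZ3_of_slabCrossing_le (r := 4) (by norm_num) hc'' ?_
  rw [frequently_atTop] at hSB ⊢
  intro N
  obtain ⟨w, hwN, hw⟩ := hSB N
  refine ⟨q * w, hwN.trans (le_mul_of_one_le_left (Nat.zero_le _) hq), ?_⟩
  have h := key w hw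
  rw [probReal_compl_eq_one_sub (measurableSet_slabCrossing _ _ _ _)] at h
  linarith

/-- **(SB) + (BR_j) ⇒ `θ(p_c) = 0` on `ℤ³`.**  The paper's last reduction (§8.1), end to end in
the kernel: the square-beam seed with some `ε = 1/q` and `c > 0` (all orientations, all large
scales) together with the windowed reflection step (BR_j) for some fixed `j ≥ 1` imply
`PercolationContinuityZ3`. -/
theorem percolationContinuityZ3_of_squareBeamSeed {q j : ℕ} (hq : 1 ≤ q) {c : ℝ} (hc : 0 < c)
    (hSB : SquareBeamSeed q c) (hBR : ReflectionStepFrac j) : PercolationContinuityZ3 := by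
  refine percolationContinuityZ3_of_twoScaleSeed hq hc (Eventually.frequently ?_) hBR
  have hall : ∀ᶠ u : ℕ in atTop, ∀ k₀ k₁ : Fin 3, k₀ ≠ k₁ →
      c ≤ (bondPercolation (zdGraph 3) (criticalProbI 3)).real
        (vertCrossing (q * u) (q * u) k₀ k₁ 0 ((q + 1) * u : ℕ))ᶜ := by
    refine eventually_all.2 fun k₀ => eventually_all.2 fun k₁ => ?_
    by_cases hk : k₀ = k₁
    · exact Eventually.of_forall fun u h => (h hk).elim
    · exact (hSB k₀ k₁ hk).mono fun u h _ => h
  obtain ⟨N, hN⟩ := eventually_atTop.1 hall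
  exact eventually_atTop.2 ⟨N, fun w hw k₀ k₁ hk =>
    ⟨hN (2 * w) (by omega) k₀ k₁ hk, hN (4 * w) (by omega) k₀ k₁ hk⟩⟩

end SurfaceTension

end Summit.CriticalPhenomena.PercolationContinuityZ3.Theorems

end
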